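/-
Copyright (c) 2026 The HCML crux team. All rights reserved.
Released under Apache 2.0 license as described in the file LICENSE.
Authors: K2E3-p23 (g5) (explicit-unit `hodgecm-mathlib-K2E3-p23-g5`)
-/
import Summits.HodgeConjecture.HodgeConjecture.Theorems.K2E3GL3ModCocompactCentral       -- ★ (B0a) p857674 (K2E3-p23 (g4)): `G_Λ`, `t2Space_quotScalar`; brings ★ GL-U, ★ GL-P, Cartan
import HarnessLib

/-!
# (GL-[M6]-sc, B0a-U) `G_Λ = GL₃(F) ⧸ Λ·1` IS UNIMODULAR

Cell `hodgecm-mathlib`, Track B, line `K2_E3_EllipticInputs`; payer «GL-[M6]-sc» of leaf (11-3-split-sc) (dealer K2E3-plan (g3) D63, line lead K2E3-p23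
(g4 → g5), RULINGS #1 (M1-2) B0a «unimodular (★ GL-U pattern)»).  ★ GL-U proves that `Ḡ = GL₃(F) ⧸ Z` is unimodular; this file runs the SAME argument on
`G_Λ := GL₃(F) ⧸ Λ·1` for any subgroup `Λ ≤ F^×` (closed, for the Hausdorff property): the transpose-inverse automorphism `θ(g) = (gᵀ)⁻¹` maps `c·1 ↦ c⁻¹·1`, hence
preserves `Λ·1` and descends to a bi-continuous involution `θ_Λ` of `G_Λ` with `θ_Λ(t) = t⁻¹` on the torus classes, so `Δ(t) = Δ(t)⁻¹ = 1` (★ GL-U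
`modularCharacter_mulEquiv_eq`); `Δ = 1` on the compact image `K_Λ` of `GL₃(𝒪)` (★ `modularCharacter_eq_one_of_mem_isCompact`); and `G_Λ = K_Λ · T · K_Λ` by the
Cartan decomposition ★ `exists_glInt_mul_mul_eq_zpowDiagGL`.

* §1 `transposeInv_scalar`, `map_transposeInv_mapScalar` (`θ(Λ·1) = Λ·1`).
* §2 `modularCharacter_mk_zpowDiagGL_eq_one` (the descent `θ_Λ = QuotientGroup.congr`, an involution; `Δ(t̄) = 1`).
* §3 `isCompact_kLambda`, **`modularCharacter_quotScalar_eq_one`**, **`isMulRightInvariant_quotScalar_of_isHaarMeasure`** — discharges the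
  `[μ.IsMulRightInvariant]` binders of ★ F2 ∕ FC-A ∕ F3a′ at `G := G_Λ` (B1-Φ, B3).

HONEST LABEL: HC_CM is proved only modulo the 7 printed citations (2 remaining named inputs: hLiu418 = stmt-HodgeConjecture-24832, h413 =
stmt-HodgeConjecture-24833) until rung 0 closes; structure theory, count-neutral (kernel lane `--supports stmt-HodgeConjecture-24833 --as helper`), THEOREMS ONLY.

References: Folland 1995 §2.4 (modular function, automorphisms) [cite: Folland1995, §2.4]; Cartier 1979 §I.3 (reductive groups are unimodular)
[cite: Cartier1979, §I.3]; Bruhat–Tits 1972 (4.4.3) (Cartan decomposition) [cite: BruhatTits1972, (4.4.3)].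
-/

open MeasureTheory MeasureTheory.Measure Set Function Filter
open scoped NNReal ENNReal MatrixGroups Pointwise WithZero Valued Topology
open Matrix ValuativeRel
open Literature.NumberTheory.Automorphic Literature.MeasureTheory.Group
open Literature.NumberTheory.GaloisRepresentations Literature.NumberTheory.GaloisRepresentations.IsNonarchimedeanLocalField
open Summit.HodgeConjecture.HodgeConjecture.Cruxes.H413.K2E3GL3ModCentre Summit.HodgeConjecture.HodgeConjecture.Cruxes.H413.K2E3GL3ModCentreUnimodular
open Summit.HodgeConjecture.HodgeConjecture.Cruxes.H413.K2E3GL3ModCocompactCentral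

set_option linter.dupNamespace false

noncomputable section

namespace Summit.HodgeConjecture.HodgeConjecture.Cruxes.H413.K2E3GL3ModCocompactUnimodular

/-! ## §1 `θ(c·1) = c⁻¹·1` and `θ(Λ·1) = Λ·1` -/

section Algebra

variable {F : Type*} [Field F]

/-- `θ(c·1) = c⁻¹·1` for the transpose-inverse automorphism `θ(g) = (gᵀ)⁻¹` (scalar matrices are symmetric). [folklore] -/
theorem transposeInv_scalar (c : Fˣ) :
    ((glTranspose (Fin 3)).trans (MulEquiv.inv' (GL (Fin 3) F)).symm) (Matrix.GeneralLinearGroup.scalar (Fin 3) c) =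
      Matrix.GeneralLinearGroup.scalar (Fin 3) c⁻¹ := by
  have ht : (glTranspose (Fin 3) (Matrix.GeneralLinearGroup.scalar (Fin 3) c)).unop = Matrix.GeneralLinearGroup.scalar (Fin 3) c := by
    apply Units.ext
    rw [coe_unop_glTranspose, Matrix.GeneralLinearGroup.coe_scalar, Matrix.scalar_apply, Matrix.diagonal_transpose]
  rw [map_inv]
  simp [MulEquiv.trans_apply, ht]

/-- **`θ(Λ·1) = Λ·1`**: the subgroup `Λ·1` is stable under `θ` (as `Λ` is inverse-closed). [folklore] -/
theorem map_transposeInv_mapScalar (Λ₀ : Subgroup Fˣ) :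
    (Λ₀.map (Matrix.GeneralLinearGroup.scalar (Fin 3))).map ((glTranspose (Fin 3)).trans (MulEquiv.inv' (GL (Fin 3) F)).symm).toMonoidHom =
      Λ₀.map (Matrix.GeneralLinearGroup.scalar (Fin 3)) := by
  ext x
  constructor
  · rintro ⟨y, ⟨c, hc, rfl⟩, rfl⟩
    exact ⟨c⁻¹, inv_mem hc, by rw [MulEquiv.coe_toMonoidHom, transposeInv_scalar]⟩
  · rintro ⟨c, hc, rfl⟩
    exact ⟨Matrix.GeneralLinearGroup.scalar (Fin 3) c⁻¹, ⟨c⁻¹, inv_mem hc, rfl⟩, by rw [MulEquiv.coe_toMonoidHom, transposeInv_scalar, inv_inv]⟩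

end Algebra

/-! ## §2 The descent `θ_Λ` and `Δ_{G_Λ}(t̄) = 1` on the torus classes -/

section Torus

variable {F : Type*} [Field F] [Valued F ℤᵐ⁰] [ValuativeRel F] [(Valued.v : Valuation F ℤᵐ⁰).Compatible] [IsNonarchimedeanLocalField F]
  (Λ₀ : Subgroup Fˣ) [(Λ₀.map (Matrix.GeneralLinearGroup.scalar (Fin 3))).Normal]
  [MeasurableSpace (GL (Fin 3) F ⧸ Λ₀.map (Matrix.GeneralLinearGroup.scalar (Fin 3)))] [BorelSpace (GL (Fin 3) F ⧸ Λ₀.map (Matrix.GeneralLinearGroup.scalar (Fin 3)))]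

omit [(Valued.v : Valuation F ℤᵐ⁰).Compatible] in
/-- **`Δ_{G_Λ}(t̄) = 1` on the torus classes** (any `Λ`, no Hausdorff hypothesis): `θ` descends to the bi-continuous involution `θ_Λ = QuotientGroup.congr` of `G_Λ` (§1), `θ_Λ(t̄) = t̄⁻¹`, so
`Δ(t̄)⁻¹ = Δ(θ_Λ t̄) = Δ(t̄)` (★ GL-U `modularCharacter_mulEquiv_eq`) and `Δ(t̄) = 1` in `ℝ≥0`. [cite: Folland1995, §2.4] [cite: Cartier1979, §I.3] -/
theorem modularCharacter_mk_zpowDiagGL_eq_one [LocallyCompactSpace (GL (Fin 3) F)] {ϖ : F} (hϖ0 : ϖ ≠ 0) (e : Fin 3 → ℤ) :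
    modularCharacter (QuotientGroup.mk' (Λ₀.map (Matrix.GeneralLinearGroup.scalar (Fin 3))) (zpowDiagGL (n := 3) hϖ0 e)) = 1 := by
  haveI : SecondCountableTopology (GL (Fin 3) F) := secondCountableTopology_gl3 F
  -- the automorphism and its descent
  set θ : GL (Fin 3) F ≃* GL (Fin 3) F := (glTranspose (Fin 3)).trans (MulEquiv.inv' (GL (Fin 3) F)).symm with hθ
  have hθc : Continuous θ := continuous_transposeInv
  have hN : (Λ₀.map (Matrix.GeneralLinearGroup.scalar (Fin 3))).map θ.toMonoidHom = Λ₀.map (Matrix.GeneralLinearGroup.scalar (Fin 3)) :=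
    map_transposeInv_mapScalar Λ₀
  set θb : (GL (Fin 3) F ⧸ Λ₀.map (Matrix.GeneralLinearGroup.scalar (Fin 3))) ≃* (GL (Fin 3) F ⧸ Λ₀.map (Matrix.GeneralLinearGroup.scalar (Fin 3))) :=
    QuotientGroup.congr (Λ₀.map (Matrix.GeneralLinearGroup.scalar (Fin 3))) (Λ₀.map (Matrix.GeneralLinearGroup.scalar (Fin 3))) θ hN with hθb
  have hθb_mk : ∀ g : GL (Fin 3) F, θb (QuotientGroup.mk g) = QuotientGroup.mk (θ g) := fun g => QuotientGroup.congr_mk _ _ θ hN g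
  have hθbc : Continuous θb := by
    refine (QuotientGroup.isQuotientMap_mk (Λ₀.map (Matrix.GeneralLinearGroup.scalar (Fin 3)))).continuous_iff.2 ?_
    have : (θb : _ → _) ∘ QuotientGroup.mk = QuotientGroup.mk ∘ θ := funext fun g => hθb_mk g
    rw [this]; exact QuotientGroup.continuous_mk.comp hθc
  -- `θb` is an involution, hence `θb.symm = θb` is continuous too
  have hinv : ∀ x, θb (θb x) = x := by
    intro x
    induction x using QuotientGroup.induction_on with
    | H g => rw [hθb_mk, hθb_mk, hθ, transposeInv_transposeInv]
  have hsymm : ∀ x, θb.symm x = θb x := fun x => by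
    conv_lhs => rw [← hinv x]
    exact θb.symm_apply_apply _
  have hθbsc : Continuous θb.symm := by
    have : (θb.symm : _ → _) = θb := funext hsymm
    rw [this]; exact hθbc
  -- `θb t̄ = t̄⁻¹`
  have ht : θb (QuotientGroup.mk' (Λ₀.map (Matrix.GeneralLinearGroup.scalar (Fin 3))) (zpowDiagGL (n := 3) hϖ0 e)) =
      (QuotientGroup.mk' (Λ₀.map (Matrix.GeneralLinearGroup.scalar (Fin 3))) (zpowDiagGL (n := 3) hϖ0 e))⁻¹ := by
    rw [QuotientGroup.mk'_apply, hθb_mk, hθ, transposeInv_zpowDiagGL, QuotientGroup.mk_inv]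
  have hΔ := modularCharacter_mulEquiv_eq θb hθbc hθbsc (QuotientGroup.mk' (Λ₀.map (Matrix.GeneralLinearGroup.scalar (Fin 3))) (zpowDiagGL (n := 3) hϖ0 e))
  rw [ht, map_inv] at hΔ
  -- `x⁻¹ = x`, `x > 0` ⇒ `x = 1` (in `ℝ`)
  set x : ℝ≥0 := modularCharacter (QuotientGroup.mk' (Λ₀.map (Matrix.GeneralLinearGroup.scalar (Fin 3))) (zpowDiagGL (n := 3) hϖ0 e)) with hx
  have hxpos : (0 : ℝ) < (x : ℝ) := by
    exact_mod_cast modularCharacterFun_pos (G := GL (Fin 3) F ⧸ Λ₀.map (Matrix.GeneralLinearGroup.scalar (Fin 3))) _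
  have hxinv : ((x : ℝ))⁻¹ = (x : ℝ) := by rw [← NNReal.coe_inv, hΔ]
  have hxx : (x : ℝ) * (x : ℝ) = 1 := by
    calc (x : ℝ) * (x : ℝ) = ((x : ℝ))⁻¹ * (x : ℝ) := by rw [hxinv]
      _ = 1 := inv_mul_cancel₀ hxpos.ne'
  have hreal : (x : ℝ) = 1 := by
    rcases mul_self_eq_one_iff.1 hxx with h | h
    · exact h
    · linarith
  exact_mod_cast hreal

end Torus

/-! ## §3 `Δ ≡ 1` on `G_Λ` and right invariance -/

section KLambda

variable {F : Type*} [Field F] [ValuativeRel F] [TopologicalSpace F] [IsNonarchimedeanLocalField F]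
  (Λ₀ : Subgroup Fˣ) [(Λ₀.map (Matrix.GeneralLinearGroup.scalar (Fin 3))).Normal]

/-- `K_Λ = image of GL₃(𝒪)` in `G_Λ` is compact (★ `isCompact_glInt`). [cite: Cartier1979, §IV.1] -/
theorem isCompact_kLambda :
    IsCompact (((glInt 3 F).map (QuotientGroup.mk' (Λ₀.map (Matrix.GeneralLinearGroup.scalar (Fin 3)))) :
      Set (GL (Fin 3) F ⧸ Λ₀.map (Matrix.GeneralLinearGroup.scalar (Fin 3))))) := by
  rw [Subgroup.coe_map, QuotientGroup.coe_mk']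
  exact (isCompact_glInt 3 F).image QuotientGroup.continuous_mk

/-- `K_Λ` is open (★ `isOpen_glInt`, `mk` is an open map). [cite: Cartier1979, §IV.1] -/
theorem isOpen_kLambda :
    IsOpen (((glInt 3 F).map (QuotientGroup.mk' (Λ₀.map (Matrix.GeneralLinearGroup.scalar (Fin 3)))) :
      Set (GL (Fin 3) F ⧸ Λ₀.map (Matrix.GeneralLinearGroup.scalar (Fin 3))))) := by
  rw [Subgroup.coe_map, QuotientGroup.coe_mk']
  exact QuotientGroup.isOpenMap_coe _ (isOpen_glInt 3 F)

end KLambda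

section Unimodular

variable {F : Type*} [Field F] [Valued F ℤᵐ⁰] [ValuativeRel F] [(Valued.v : Valuation F ℤᵐ⁰).Compatible] [IsNonarchimedeanLocalField F]
  (Λ₀ : Subgroup Fˣ) [(Λ₀.map (Matrix.GeneralLinearGroup.scalar (Fin 3))).Normal]
  [MeasurableSpace (GL (Fin 3) F ⧸ Λ₀.map (Matrix.GeneralLinearGroup.scalar (Fin 3)))] [BorelSpace (GL (Fin 3) F ⧸ Λ₀.map (Matrix.GeneralLinearGroup.scalar (Fin 3)))]

/-- **THE MODULAR CHARACTER OF `G_Λ = GL₃(F) ⧸ Λ·1` IS TRIVIAL** (`Λ` closed): `Δ = 1` on the compact `K_Λ` (★ `modularCharacter_eq_one_of_mem_isCompact`) and on the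
torus classes (§2), and `g = k₁⁻¹ t k₂⁻¹` by the Cartan decomposition ★ `exists_glInt_mul_mul_eq_zpowDiagGL`. [cite: Cartier1979, §I.3] [cite: BruhatTits1972, (4.4.3)] -/
theorem modularCharacter_quotScalar_eq_one [LocallyCompactSpace (GL (Fin 3) F)] (hΛ : IsClosed (Λ₀ : Set Fˣ)) {ϖ : F}
    (hϖ : Valued.v ϖ = WithZero.exp (-1 : ℤ)) (x : GL (Fin 3) F ⧸ Λ₀.map (Matrix.GeneralLinearGroup.scalar (Fin 3))) : modularCharacter x = 1 := by
  haveI : SecondCountableTopology (GL (Fin 3) F) := secondCountableTopology_gl3 F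
  haveI : T2Space (GL (Fin 3) F ⧸ Λ₀.map (Matrix.GeneralLinearGroup.scalar (Fin 3))) := t2Space_quotScalar Λ₀ hΛ
  haveI := isDiscreteValuationRing_integer_of_compatible hϖ
  have hu : IsUniformizingElement ϖ := isUniformizingElement_of_v_eq hϖ
  have hKc := isCompact_kLambda Λ₀
  induction x using QuotientGroup.induction_on with
  | H g =>
    obtain ⟨k₁, hk₁, k₂, hk₂, a, -, heq⟩ := exists_glInt_mul_mul_eq_zpowDiagGL hu g
    have hg : g = k₁⁻¹ * zpowDiagGL hu.ne_zero a * k₂⁻¹ := by rw [← heq]; group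
    have h1 : (QuotientGroup.mk k₁⁻¹ : GL (Fin 3) F ⧸ Λ₀.map (Matrix.GeneralLinearGroup.scalar (Fin 3))) ∈
        (glInt 3 F).map (QuotientGroup.mk' (Λ₀.map (Matrix.GeneralLinearGroup.scalar (Fin 3)))) := Subgroup.mem_map.2 ⟨k₁⁻¹, inv_mem hk₁, rfl⟩
    have h2 : (QuotientGroup.mk k₂⁻¹ : GL (Fin 3) F ⧸ Λ₀.map (Matrix.GeneralLinearGroup.scalar (Fin 3))) ∈
        (glInt 3 F).map (QuotientGroup.mk' (Λ₀.map (Matrix.GeneralLinearGroup.scalar (Fin 3)))) := Subgroup.mem_map.2 ⟨k₂⁻¹, inv_mem hk₂, rfl⟩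
    have ht := modularCharacter_mk_zpowDiagGL_eq_one Λ₀ hu.ne_zero a
    rw [QuotientGroup.mk'_apply] at ht
    rw [hg, QuotientGroup.mk_mul, QuotientGroup.mk_mul, map_mul, map_mul, modularCharacter_eq_one_of_mem_isCompact _ hKc h1,
      modularCharacter_eq_one_of_mem_isCompact _ hKc h2, ht, one_mul, one_mul]

/-- **`G_Λ = GL₃(F) ⧸ Λ·1` IS UNIMODULAR** (`Λ ≤ F^×` closed): every Haar measure on it is right invariant. [cite: Cartier1979, §I.3] [cite: Folland1995, §2.4] -/
theorem isMulRightInvariant_quotScalar_of_isHaarMeasure (hΛ : IsClosed (Λ₀ : Set Fˣ)) {ϖ : F} (hϖ : Valued.v ϖ = WithZero.exp (-1 : ℤ))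
    (μ : Measure (GL (Fin 3) F ⧸ Λ₀.map (Matrix.GeneralLinearGroup.scalar (Fin 3)))) [μ.IsHaarMeasure] : μ.IsMulRightInvariant := by
  haveI : SecondCountableTopology (GL (Fin 3) F) := secondCountableTopology_gl3 F
  haveI : LocallyCompactSpace (GL (Fin 3) F) := locallyCompactSpace_gl3 F
  haveI : T2Space (GL (Fin 3) F ⧸ Λ₀.map (Matrix.GeneralLinearGroup.scalar (Fin 3))) := t2Space_quotScalar Λ₀ hΛ
  refine ⟨fun g => ?_⟩
  rw [map_mul_right_eq_modularCharacter_smul μ g, modularCharacter_quotScalar_eq_one Λ₀ hΛ hϖ g, one_smul]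

end Unimodular

end Summit.HodgeConjecture.HodgeConjecture.Cruxes.H413.K2E3GL3ModCocompactUnimodular

end
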